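import Mathlib
import Summits.RiemannHypothesis.RiemannHypothesis.Theorems.IntegerScrewExitFlatDensity
import Summits.RiemannHypothesis.RiemannHypothesis.Theorems.IntegerScrewTheoremA
import Literature.NumberTheory.LFunctions.MertensTail
import HarnessLib

/-!
# Route `IntegerScrew` — THEOREM B, preparations: the cell's inequalities, the two prime-Mertens constants
# from the tree, and the flattened density range `m_hi − m_lo ≤ 90·log R/log²(Q+1)` (CONTINUUM-LIMIT §26.4)

For the cell `299 ≤ p`, `298p ≤ R < p²`, `Q = R/p`, with the sharp Green data `A = 1 + 4/log(Q+1)`,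
`B = 1 − 5/log(Q+1)`, `c′ = 1` (`IntegerScrewTheoremAPrep`) and `E_hi = log 4`, `E_lo = 3`
(`Literature…MertensBound.sum_log_div_prime_le`, `…log_sub_three_le_sum_log_div_prime`):

* `sum_Icc_primeLogDiv_eq`, `primeMertens_hi`, `primeMertens_lo` — the prime sums in the `primeLogDiv` form of
  `IntegerScrewExitTilt`;
* `cell_nat_facts`, `cell_log_facts` — `298 ≤ Q`, `2Q ≤ R`, `Q < p`; `L < 2λ`, `λ − λ₁ ≤ 1/298`, `L ≤ 2.01λ₁`,
  `5 ≤ log(Q+1) ≤ L` (`L = log R`, `λ = log p`, `λ₁ = log(p−1)`);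
* **`flat_range_width_le`** — the bounds `m_hi`, `m_lo` of `IntegerScrewExitFlatDensity` satisfy
  `m_hi − m_lo ≤ 90·L/log²(Q+1)`;
* **`flat_chiSq_le_sharp`** — the flattened χ² of the cell is `≤ (1 + log Q)·(90·L/log²(Q+1))²`.

Consumed by `IntegerScrewTheoremB`.
RH-free, elementary.  Nothing in this file bears on the truth of RH.
References: CONTINUUM-LIMIT §25–26 (rh-explicit A6-PIVOT); M. Suzuki, J. Lond. Math. Soc. (2) 108 (2023)
1448–1487 [Suzuki2023] for the screw matrices this serves.
-/

noncomputable section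

set_option linter.dupNamespace false -- D-0017: `Summit.<S>.<S>.…` is the designed namespace

namespace Summit.RiemannHypothesis.RiemannHypothesis.Theorems.IntegerScrew

open Finset Real
open ArithmeticFunction (vonMangoldt)

/-! ### The two prime Mertens constants from the tree: `E_hi = log 4`, `E_lo = 3` -/

/-- `Σ_{k≤n} primeLogDiv k = Σ_{p≤n} log p/p`. -/
theorem sum_Icc_primeLogDiv_eq (n : ℕ) :
    ∑ k ∈ Icc 1 n, primeLogDiv k = ∑ q ∈ Nat.primesLE n, Real.log q / q := by
  rw [← Literature.NumberTheory.LFunctions.MertensBound.sum_Icc_ite_prime_log_div n]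
  have hI : Icc 0 n = insert 0 (Icc 1 n) := by
    ext k; simp only [Finset.mem_insert, Finset.mem_Icc]; omega
  rw [hI, Finset.sum_insert (by simp)]
  simp [primeLogDiv, Nat.not_prime_zero]

/-- `Σ_{p≤n} log p/p ≤ log n + log 4` in the `primeLogDiv` form (tree: `MertensBound.sum_log_div_prime_le`). -/
theorem primeMertens_hi : ∀ n : ℕ, 1 ≤ n → ∑ k ∈ Icc 1 n, primeLogDiv k ≤ Real.log n + Real.log 4 := by
  intro n _
  rw [sum_Icc_primeLogDiv_eq]
  exact Literature.NumberTheory.LFunctions.MertensBound.sum_log_div_prime_le n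

/-- `log n − 3 ≤ Σ_{p≤n} log p/p` in the `primeLogDiv` form (tree: `MertensBound.log_sub_three_le_sum_log_div_prime`). -/
theorem primeMertens_lo : ∀ n : ℕ, 1 ≤ n → Real.log n - 3 ≤ ∑ k ∈ Icc 1 n, primeLogDiv k := by
  intro n _
  rw [sum_Icc_primeLogDiv_eq]
  exact Literature.NumberTheory.LFunctions.MertensBound.log_sub_three_le_sum_log_div_prime n

/-! ### The cell's elementary inequalities -/

/-- In the cell `299 ≤ p`, `298p ≤ R < p²`: `148 ≤ R/p`, `298 ≤ R/p`, `2(R/p) ≤ R`, `R/p < p`. -/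
theorem cell_nat_facts {R p : ℕ} (hp : 299 ≤ p) (hpR : 298 * p ≤ R) (hR : R < p ^ 2) :
    298 ≤ R / p ∧ 2 * (R / p) ≤ R ∧ R / p < p := by
  refine ⟨(Nat.le_div_iff_mul_le (by omega)).2 (by linarith), ?_, (Nat.div_lt_iff_lt_mul (by omega)).2 (by nlinarith)⟩
  have h1 : R / p * p ≤ R := Nat.div_mul_le_self R p
  have h2 : 2 * (R / p) ≤ R / p * p := by nlinarith [Nat.zero_le (R / p)]
  omega

/-- The logarithms of the cell: with `L = log R`, `λ = log p`, `λ₁ = log(p−1)`, `ℓ₁ = log(R/p + 1)`: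
`L < 2λ`, `λ − λ₁ ≤ 1/298`, `0 < λ₁`, `L ≤ 2.01·λ₁`, `5 ≤ ℓ₁ ≤ L`. -/
theorem cell_log_facts {R p : ℕ} (hp : 299 ≤ p) (hpR : 298 * p ≤ R) (hR : R < p ^ 2) :
    Real.log R < 2 * Real.log p ∧ Real.log p - Real.log ((p - 1 : ℕ) : ℝ) ≤ 1 / 298 ∧
      0 < Real.log ((p - 1 : ℕ) : ℝ) ∧ Real.log R ≤ 2.01 * Real.log ((p - 1 : ℕ) : ℝ) ∧
      5 ≤ Real.log (((R / p : ℕ) : ℝ) + 1) ∧ Real.log (((R / p : ℕ) : ℝ) + 1) ≤ Real.log R := by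
  obtain ⟨hQ, h2Q, hQp⟩ := cell_nat_facts hp hpR hR
  have hpr : (299 : ℝ) ≤ p := by exact_mod_cast hp
  have hp1r : ((p - 1 : ℕ) : ℝ) = (p : ℝ) - 1 := by
    rw [Nat.cast_sub (by omega)]; push_cast; ring
  have hRr : (R : ℝ) < (p : ℝ) ^ 2 := by exact_mod_cast hR
  have hR1 : (1 : ℝ) ≤ R := by exact_mod_cast (show 1 ≤ R by omega)
  have hL2 : Real.log R < 2 * Real.log p := by
    have h := Real.log_lt_log (by linarith : (0 : ℝ) < R) hRr
    rw [Real.log_pow] at h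
    push_cast at h
    linarith
  have hlam1 : Real.log p - Real.log ((p - 1 : ℕ) : ℝ) ≤ 1 / 298 := by
    rw [hp1r, ← Real.log_div (by linarith) (by linarith)]
    have h := Real.log_le_sub_one_of_pos (show 0 < (p : ℝ) / ((p : ℝ) - 1) by
      exact div_pos (by linarith) (by linarith))
    have hp1ne : (p : ℝ) - 1 ≠ 0 := by linarith
    have e : (p : ℝ) / ((p : ℝ) - 1) - 1 = 1 / ((p : ℝ) - 1) := by
      field_simp
      ring
    rw [e] at h
    exact h.trans (one_div_le_one_div_of_le (by norm_num) (by linarith))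
  have hlam1pos : 0 < Real.log ((p - 1 : ℕ) : ℝ) := by rw [hp1r]; exact Real.log_pos (by linarith)
  have hlam1' : 5 ≤ Real.log ((p - 1 : ℕ) : ℝ) := by
    have := five_le_log_succ (show 148 ≤ p - 2 by omega)
    have hc : ((p - 2 : ℕ) : ℝ) + 1 = ((p - 1 : ℕ) : ℝ) := by
      rw [Nat.cast_sub (by omega), Nat.cast_sub (by omega)]; push_cast; ring
    rw [hc] at this; exact this
  have hL201 : Real.log R ≤ 2.01 * Real.log ((p - 1 : ℕ) : ℝ) := by linarith
  have hℓ5 : 5 ≤ Real.log (((R / p : ℕ) : ℝ) + 1) := five_le_log_succ (by omega)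
  have hℓL : Real.log (((R / p : ℕ) : ℝ) + 1) ≤ Real.log R := by
    refine Real.log_le_log (by positivity) ?_
    have : ((R / p : ℕ) : ℝ) + 1 ≤ ((2 * (R / p) : ℕ) : ℝ) := by
      push_cast
      have : (1 : ℝ) ≤ ((R / p : ℕ) : ℝ) := by exact_mod_cast (show 1 ≤ R / p by omega)
      linarith
    exact this.trans (by exact_mod_cast h2Q)
  exact ⟨hL2, hlam1, hlam1pos, hL201, hℓ5, hℓL⟩

/-! ### The width of the flattened density range -/

/-- **The flattened range.**  With `Q = R/p`, `ℓ₁ = log(Q+1)`, `L = log R`, `λ = log p`, `λ₁ = log(p−1)`,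
`A = 1 + 4/ℓ₁`, `B = 1 − 5/ℓ₁`, `c′ = 1`, `c = E_lo + E_hi = 3 + log 4`, the bounds `m_hi`, `m_lo` of
`IntegerScrewExitFlatDensity` satisfy, for `299 ≤ p`, `298p ≤ R < p²`:  `m_hi − m_lo ≤ 90·L/ℓ₁²`
(`A·L·U₀ − B·L·L₀ ≤ 20L/ℓ₁²` by `density_range_width_le`; `(1−B)L/λ ≤ 10/ℓ₁`; `B − A ≤ 0`;
`(A+B)Lc/λ₁² ≤ 49.7/L`; `(A−1)L/λ₁ ≤ 8.04/ℓ₁`; `L(λ−λ₁)/λ₁² ≤ 0.014/L`; `1/ℓ₁, 1/L ≤ L/ℓ₁²`). -/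
theorem flat_range_width_le {R p : ℕ} (hp : 299 ≤ p) (hpR : 298 * p ≤ R) (hR : R < p ^ 2) :
    ((1 + 4 / Real.log (((R / p : ℕ) : ℝ) + 1)) * Real.log R *
            (1 / Real.log (((R / p : ℕ) : ℝ) + 1) - 1 / Real.log R +
              (39 / 50 + 1 + 2 * Real.log 2) / Real.log (((R / p : ℕ) : ℝ) + 1) ^ 2) +
          (1 - (1 - 5 / Real.log (((R / p : ℕ) : ℝ) + 1))) * Real.log R / Real.log p +
            (1 - 5 / Real.log (((R / p : ℕ) : ℝ) + 1)) +
          (1 - 5 / Real.log (((R / p : ℕ) : ℝ) + 1)) * Real.log R * (3 + Real.log 4) /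
            Real.log ((p - 1 : ℕ) : ℝ) ^ 2) -
        ((1 - 5 / Real.log (((R / p : ℕ) : ℝ) + 1)) * Real.log R *
            (1 / Real.log (2 * ((R / p : ℕ) : ℝ)) - 1 / (Real.log R - Real.log 2) -
              (39 / 50 + 1 + Real.log 2) / Real.log (((R / p : ℕ) : ℝ) + 1) ^ 2) +
            (1 + 4 / Real.log (((R / p : ℕ) : ℝ) + 1)) -
            (1 + 4 / Real.log (((R / p : ℕ) : ℝ) + 1) - 1) * Real.log R / Real.log ((p - 1 : ℕ) : ℝ) -
            Real.log R * (Real.log p - Real.log ((p - 1 : ℕ) : ℝ)) / Real.log ((p - 1 : ℕ) : ℝ) ^ 2 -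
          (1 + 4 / Real.log (((R / p : ℕ) : ℝ) + 1)) * Real.log R * (3 + Real.log 4) /
            Real.log ((p - 1 : ℕ) : ℝ) ^ 2) ≤
      90 * Real.log R / Real.log (((R / p : ℕ) : ℝ) + 1) ^ 2 := by
  obtain ⟨hQ, h2Q, hQp⟩ := cell_nat_facts hp hpR hR
  obtain ⟨hL2, hlamd, hlam1pos, hL201, ha5, haL⟩ := cell_log_facts hp hpR hR
  have hdens := density_range_width_le (show 148 ≤ R / p by omega) h2Q
  set a := Real.log (((R / p : ℕ) : ℝ) + 1) with ha_def
  set L := Real.log (R : ℝ) with hL_def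
  set lam := Real.log (p : ℝ) with hlam_def
  set lam1 := Real.log ((p - 1 : ℕ) : ℝ) with hlam1_def
  set c := (3 : ℝ) + Real.log 4 with hc_def
  have hl4 : Real.log 4 ≤ 1.3863 := by
    rw [show (4 : ℝ) = 2 ^ 2 by norm_num, Real.log_pow]; have := Real.log_two_lt_d9; push_cast; linarith
  have hl4' : 0 ≤ Real.log 4 := Real.log_nonneg (by norm_num)
  have ha0 : 0 < a := by linarith
  have hL0 : 0 < L := by linarith
  have hlam0 : 0 < lam := by linarith
  have h4a : 0 ≤ 4 / a := by positivity
  have h5a : 0 ≤ 5 / a := by positivity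
  have h4a' : 4 / a ≤ 4 / 5 := div_le_div_of_nonneg_left (by norm_num) (by norm_num) ha5
  have h5a' : 5 / a ≤ 5 / 5 := div_le_div_of_nonneg_left (by norm_num) (by norm_num) ha5
  set A := 1 + 4 / a with hA_def
  set B := 1 - 5 / a with hB_def
  have hA1 : 1 ≤ A := by rw [hA_def]; linarith
  have hA2 : A ≤ 9 / 5 := by rw [hA_def]; linarith
  have hB0 : 0 ≤ B := by rw [hB_def]; linarith
  have hB1 : B ≤ 1 := by rw [hB_def]; linarith
  -- name the six differences
  set D1 := A * L * (1 / a - 1 / L + (39 / 50 + 1 + 2 * Real.log 2) / a ^ 2) -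
    B * L * (1 / Real.log (2 * ((R / p : ℕ) : ℝ)) - 1 / (L - Real.log 2) - (39 / 50 + 1 + Real.log 2) / a ^ 2)
    with hD1
  -- the target rearranged
  have hsplit : (A * L * (1 / a - 1 / L + (39 / 50 + 1 + 2 * Real.log 2) / a ^ 2) +
          (1 - B) * L / lam + B + B * L * c / lam1 ^ 2) -
        (B * L * (1 / Real.log (2 * ((R / p : ℕ) : ℝ)) - 1 / (L - Real.log 2) - (39 / 50 + 1 + Real.log 2) / a ^ 2) +
            A - (A - 1) * L / lam1 - L * (lam - lam1) / lam1 ^ 2 - A * L * c / lam1 ^ 2) =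
      D1 + (1 - B) * L / lam + (B - A) + (A + B) * L * c / lam1 ^ 2 + (A - 1) * L / lam1 +
        L * (lam - lam1) / lam1 ^ 2 := by
    rw [hD1]; ring
  -- (i) D1 ≤ 20 L/a²
  have hD1le : D1 ≤ 20 * L / a ^ 2 := by rw [hD1]; exact hdens
  -- unit conversions: 1/a ≤ L/a², 1/L ≤ L/a², 1/lam1 ≤ 2.01/L
  have hLa2 : 0 < L / a ^ 2 := by positivity
  have h1a : 1 / a ≤ L / a ^ 2 := by
    rw [div_le_div_iff₀ ha0 (by positivity), one_mul, sq]
    exact mul_le_mul_of_nonneg_right haL ha0.le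
  have h1L : 1 / L ≤ L / a ^ 2 := by
    rw [div_le_div_iff₀ hL0 (by positivity), one_mul, ← sq]
    exact pow_le_pow_left₀ ha0.le haL 2
  have hlam1inv : 1 / lam1 ≤ 2.01 / L := by
    rw [div_le_div_iff₀ hlam1pos hL0]; linarith
  -- (ii) (1−B)L/λ = 5L/(aλ) ≤ 10/a
  have hii : (1 - B) * L / lam ≤ 10 * (L / a ^ 2) := by
    have e : (1 - B) * L / lam = 5 / a * (L / lam) := by rw [hB_def]; field_simp; ring
    have hLl : L / lam ≤ 2 := by rw [div_le_iff₀ hlam0]; linarith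
    rw [e]
    calc 5 / a * (L / lam) ≤ 5 / a * 2 := mul_le_mul_of_nonneg_left hLl h5a
      _ = 10 * (1 / a) := by ring
      _ ≤ 10 * (L / a ^ 2) := by linarith
  -- (iii) B − A ≤ 0
  have hiii : B - A ≤ 0 := by linarith
  -- (iv) (A+B)Lc/λ₁² ≤ (14/5)·c·L·(2.01/L)² = (14/5)c·4.0401/L ≤ 49.7·L/a²
  have hc1 : c ≤ 4.3863 := by rw [hc_def]; linarith
  have hc0 : 0 ≤ c := by rw [hc_def]; linarith
  have hiv : (A + B) * L * c / lam1 ^ 2 ≤ 49.7 * (L / a ^ 2) := by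
    have e : (A + B) * L * c / lam1 ^ 2 = (A + B) * c * L * (1 / lam1) ^ 2 := by
      field_simp
    rw [e]
    have h1 : (1 / lam1) ^ 2 ≤ (2.01 / L) ^ 2 := pow_le_pow_left₀ (by positivity) hlam1inv 2
    have h2 : (A + B) * c ≤ 14 / 5 * 4.3863 := mul_le_mul (by linarith) hc1 hc0 (by norm_num)
    have h3 : (A + B) * c * L * (1 / lam1) ^ 2 ≤ 14 / 5 * 4.3863 * L * (2.01 / L) ^ 2 := by
      have := mul_le_mul h2 (le_refl L) hL0.le (by norm_num)
      exact mul_le_mul this h1 (by positivity) (by positivity)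
    have h4 : 14 / 5 * 4.3863 * L * (2.01 / L) ^ 2 = 14 / 5 * 4.3863 * 2.01 ^ 2 * (1 / L) := by
      field_simp
    rw [h4] at h3
    have h5 : 14 / 5 * 4.3863 * 2.01 ^ 2 * (1 / L) ≤ 49.7 * (L / a ^ 2) :=
      mul_le_mul (by norm_num) h1L (by positivity) (by norm_num)
    exact h3.trans h5
  -- (v) (A−1)L/λ₁ = (4/a)·L/λ₁ ≤ (4/a)·2.01 ≤ 8.04·L/a²
  have hv : (A - 1) * L / lam1 ≤ 8.04 * (L / a ^ 2) := by
    have e : (A - 1) * L / lam1 = 4 / a * (L * (1 / lam1)) := by rw [hA_def]; field_simp; ring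
    rw [e]
    have h1 : L * (1 / lam1) ≤ L * (2.01 / L) := mul_le_mul_of_nonneg_left hlam1inv hL0.le
    have h2 : L * (2.01 / L) = 2.01 := by field_simp
    rw [h2] at h1
    calc 4 / a * (L * (1 / lam1)) ≤ 4 / a * 2.01 := mul_le_mul_of_nonneg_left h1 h4a
      _ = 8.04 * (1 / a) := by ring
      _ ≤ 8.04 * (L / a ^ 2) := by linarith
  -- (vi) L(λ−λ₁)/λ₁² ≤ L·(1/298)·(2.01/L)² = 4.0401/(298 L) ≤ 0.014·L/a²
  have hvi : L * (lam - lam1) / lam1 ^ 2 ≤ 0.014 * (L / a ^ 2) := by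
    have hp1pos : (0 : ℝ) < ((p - 1 : ℕ) : ℝ) := by exact_mod_cast (show 0 < p - 1 by omega)
    have hd0 : 0 ≤ lam - lam1 := by
      rw [hlam_def, hlam1_def]
      exact sub_nonneg.2 (Real.log_le_log hp1pos (by exact_mod_cast Nat.sub_le p 1))
    have e : L * (lam - lam1) / lam1 ^ 2 = L * (lam - lam1) * (1 / lam1) ^ 2 := by
      field_simp
    rw [e]
    have h1 : (1 / lam1) ^ 2 ≤ (2.01 / L) ^ 2 := pow_le_pow_left₀ (by positivity) hlam1inv 2
    have h2 : L * (lam - lam1) ≤ L * (1 / 298) := mul_le_mul_of_nonneg_left hlamd hL0.le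
    have h3 : L * (lam - lam1) * (1 / lam1) ^ 2 ≤ L * (1 / 298) * (2.01 / L) ^ 2 :=
      mul_le_mul h2 h1 (by positivity) (by positivity)
    have h4 : L * (1 / 298) * (2.01 / L) ^ 2 = 2.01 ^ 2 / 298 * (1 / L) := by
      field_simp
    rw [h4] at h3
    have h5 : 2.01 ^ 2 / 298 * (1 / L) ≤ 0.014 * (L / a ^ 2) :=
      mul_le_mul (by norm_num) h1L (by positivity) (by norm_num)
    exact h3.trans h5
  -- assemble
  rw [hsplit]
  have hsum : D1 + (1 - B) * L / lam + (B - A) + (A + B) * L * c / lam1 ^ 2 + (A - 1) * L / lam1 +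
      L * (lam - lam1) / lam1 ^ 2 ≤ (20 + 10 + 0 + 49.7 + 8.04 + 0.014) * (L / a ^ 2) := by
    have e0 : 20 * L / a ^ 2 = 20 * (L / a ^ 2) := by ring
    linarith [hD1le, hii, hiii, hiv, hv, hvi, e0.le, e0.ge]
  calc _ ≤ (20 + 10 + 0 + 49.7 + 8.04 + 0.014) * (L / a ^ 2) := hsum
    _ ≤ 90 * (L / a ^ 2) := mul_le_mul_of_nonneg_right (by norm_num) hLa2.le
    _ = 90 * L / a ^ 2 := by ring

/-! ### The flattened χ², explicitly -/

/-- **The flattened χ² of the cell**: for `299 ≤ p`, `298p ≤ R < p²`, with `Q = R/p` and the profile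
`T(b) = log R/(log b + log p)`:
`Σ_{b≤Q} b·(ν^𝒜(b) + T(b)/b − mean)² ≤ (1 + log Q)·(90·log R/log²(Q+1))²`. -/
theorem flat_chiSq_le_sharp {R p : ℕ} (hp : 299 ≤ p) (hpR : 298 * p ≤ R) (hR : R < p ^ 2) :
    ∑ b ∈ Icc 1 (R / p), (b : ℝ) * (exitInflowAtom R (R / p) p b + Real.log R / (Real.log b + Real.log p) / b -
        (∑ a ∈ Icc 1 (R / p), (exitInflowAtom R (R / p) p a + Real.log R / (Real.log a + Real.log p) / a)) /
          (∑ a ∈ Icc 1 (R / p), (1 : ℝ) / a) / b) ^ 2 ≤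
      (1 + Real.log ((R / p : ℕ) : ℝ)) * (90 * Real.log R / Real.log (((R / p : ℕ) : ℝ) + 1) ^ 2) ^ 2 := by
  obtain ⟨hQ, h2Q, hQp⟩ := cell_nat_facts hp hpR hR
  obtain ⟨hL2, hlamd, hlam1pos, hL201, ha5, haL⟩ := cell_log_facts hp hpR hR
  have hp3 : 3 ≤ p := by omega
  have h2p : 2 * p ≤ R := by omega
  have hA1 : 1 ≤ 1 + 4 / Real.log (((R / p : ℕ) : ℝ) + 1) := by
    have : 0 ≤ 4 / Real.log (((R / p : ℕ) : ℝ) + 1) := by positivity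
    linarith
  have h5a' : 5 / Real.log (((R / p : ℕ) : ℝ) + 1) ≤ 5 / 5 :=
    div_le_div_of_nonneg_left (by norm_num) (by norm_num) ha5
  have hB0 : 0 ≤ 1 - 5 / Real.log (((R / p : ℕ) : ℝ) + 1) := by linarith
  have hB1 : 1 - 5 / Real.log (((R / p : ℕ) : ℝ) + 1) ≤ 1 := by
    have : 0 ≤ 5 / Real.log (((R / p : ℕ) : ℝ) + 1) := by positivity
    linarith
  have hΓU := exitGamma_le_four (R := R) (show 148 ≤ R / p by omega)
  have hΓL := five_le_exitGamma (R := R) (show 148 ≤ R / p by omega)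
  have hψ := mertens_lower_one R
  have h := flat_chiSq_le hp3 h2p hR hA1 hΓU hB0 hB1 hΓL hψ primeMertens_hi primeMertens_lo
  have hw := flat_range_width_le hp hpR hR
  -- the range is non-empty (b = 1), so its width is ≥ 0
  have hlo1 := le_flatDensity hp3 h2p hR hA1 hΓU hB0 hΓL hψ primeMertens_hi primeMertens_lo
    (le_refl 1) (show 1 ≤ R / p by omega)
  have hhi1 := flatDensity_le hp3 h2p hR hA1 hΓU hB0 hB1 hΓL hψ primeMertens_hi primeMertens_lo
    (le_refl 1) (show 1 ≤ R / p by omega)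
  have hw0 := sub_nonneg.2 (hlo1.trans hhi1)
  have hH : 0 ≤ ∑ b ∈ Icc 1 (R / p), (1 : ℝ) / b := Finset.sum_nonneg fun b _ => by positivity
  refine h.trans ?_
  refine (mul_le_mul_of_nonneg_left (pow_le_pow_left₀ hw0 hw 2) hH).trans ?_
  exact mul_le_mul_of_nonneg_right (sum_Icc_inv_le_one_add_log (R / p)) (by positivity)

end Summit.RiemannHypothesis.RiemannHypothesis.Theorems.IntegerScrew

end
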